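import Mathlib
import Summits.KontsevichZagierPeriods.Zeta5Search.Families.DualBaseChartsA
import Summits.KontsevichZagierPeriods.Zeta5Search.Families.DualExactTwelve
import HarnessLib
import HarnessLib.Audit

/-!
# ζ(5) search — Families: charts 4–6 of the flip chain and the PROOF of the base identity `DualBaseIdentity`

HONEST FRAMING: systematic search; no irrationality claim unless certified.  Cell `pub-zeta5`, certifier 2
(cert-2 g8, 2026-08-22).  Pure algebra in `ℤ[[r₁..r₅]]`; nothing about `ζ(5)`; no number of record moves.

Continuation of `Families/DualBaseChartsA` (charts 0–3, generic step `ctTrivial_next`): the flips `27→04`, `47→06`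
(reaching the triangulation `T_c = {02,04,06,24,46}`) and the last half-step `04→26` on the coordinates `02`, `46`, whose
units are `u0123/u01`, `u012345/u0123` and the Plücker ratio `u0123·u2345/(u23·u012345)`.  The last chart's monomial with
exponents `s(t) = (t₅, −t₃, t₁, t₂, t₄)` is `r^{−cExp 0 t}·E(nExp 0 t)`, which gives
**`dualBaseIdentity_holds : DualBaseIdentity`** (`Families/DualExactTwelve`): the extended dual constant term satisfies
`Φ(0,t) = [t = 0]`.  With it the conditional results of cert-2 g8 (`G_eq_Phi_of_base`, `dexact_of_base`) become
unconditional — see `Families/DualExactUnconditional`.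
-/

noncomputable section

open MvPowerSeries Finset Matrix

namespace Summit.KontsevichZagierPeriods.Zeta5Search.Families.Cellular

namespace DualR

/-! ### Step 3: pivot coordinate 2 of chart 3 (flip `(2, 7)`) -/

/-- change-of-exponents matrix of step 3 (chart 4 basis → chart 3 basis). -/
def mu3 : Matrix (Fin 5) (Fin 5) ℤ := !![1, 0, 0, 0, 0; 0, 0, 1, 0, 0; 1, -1, 0, 0, 1; 0, 0, 0, 1, 0; 0, 0, 0, 0, 1]
/-- its integer inverse. -/
def muInv3 : Matrix (Fin 5) (Fin 5) ℤ := !![1, 0, 0, 0, 0; 1, 0, -1, 0, 1; 0, 1, 0, 0, 0; 0, 0, 0, 1, 0; 0, 0, 0, 0, 1]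
/-- exponents of the step unit `1 + X^ρ` on the new coordinates. -/
def b3 : Fin 5 → ℤ := ![-1, 0, 1, 0, -1]
/-- the pivot. -/
def rho3 : Fin 5 → ℤ := ![0, 0, 1, 0, 0]
/-- `r`-exponent of the pivot. -/
def alpha3 : Fin 5 →₀ ℕ := Finsupp.equivFunOnFinite.symm ![1, 1, 0, 0, 0]
/-- span-unit exponents of the step unit `1 + X^ρ`. -/
def m3 : Fin 10 → ℤ := ![-1, 0, 1, 0, 0, 0, 0, 0, 0, 0]

/-- The step unit identity `E(m) = 1 + r^α·E(N ρ)` (a Plücker relation among span units). -/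
theorem hU3 : ((E m3 : S5ˣ) : S5) = 1 + monomial alpha3 (1 : ℤ) * ((E (nMat3 *ᵥ rho3) : S5ˣ) : S5) := by
  have hm : m3 = (delta 2) - (delta 0) := by funext i; fin_cases i <;> simp [m3, delta]
  have hn : nMat3 *ᵥ rho3 = (delta 5) - (delta 0) := by
    funext i; fin_cases i <;> simp [nMat3, rho3, delta, Matrix.mulVec, dotProduct, Fin.sum_univ_five]
  rw [hm, hn, monomial_eq_prod]
  refine E_sub_eq_one_add _ _ _ _ _ ?_
  simp [E_delta, alpha3, r]
  ring

/-- Chart 4 is CT-trivial. -/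
theorem chart4_holds : CTTrivial (gam gMat4) (unitsOf nMat4) := by
  refine ctTrivial_next gMat3 nMat3 chart3_holds mu3 muInv3 ?_ b3 rho3 alpha3 ?_ ?_ m3 ?_ hU3
    gMat4 nMat4 ?_ ?_
  · ext i j; fin_cases i <;> fin_cases j <;> simp [Matrix.mul_apply, Fin.sum_univ_five, mu3, muInv3]
  · intro h; have := congrArg (fun f => f 0) h; simp [alpha3] at this
  · funext j; fin_cases j <;> simp [gMat3, rho3, alpha3, zOf, Matrix.mulVec, dotProduct, Fin.sum_univ_five]
  · intro s i hi h
    have h0 := congrFun h 0; have h1 := congrFun h 1; have h2 := congrFun h 2; have h3 := congrFun h 3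
    have h4 := congrFun h 4
    simp [mu3, rho3, dotProduct, Fin.sum_univ_five] at h0 h1 h2 h3 h4
    simp [b3, dotProduct, Fin.sum_univ_five]
    omega
  · ext i j; fin_cases i <;> fin_cases j <;> simp [Matrix.mul_apply, Fin.sum_univ_five, gMat3, gMat4, mu3]
  · intro s; funext i
    fin_cases i <;> simp [nMat3, nMat4, mu3, b3, m3, Matrix.mulVec, dotProduct, Fin.sum_univ_five]
    ring

/-! ### Step 4: pivot coordinate 4 of chart 4 (flip `(4, 7)`) -/

/-- change-of-exponents matrix of step 4 (chart 5 basis → chart 4 basis). -/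
def mu4 : Matrix (Fin 5) (Fin 5) ℤ := !![1, 0, 0, 0, 0; 0, 1, 0, 0, 0; 0, 0, 0, 1, 0; 0, 0, 0, 0, 1; 0, 1, -1, 0, 0]
/-- its integer inverse. -/
def muInv4 : Matrix (Fin 5) (Fin 5) ℤ := !![1, 0, 0, 0, 0; 0, 1, 0, 0, 0; 0, 1, 0, 0, -1; 0, 0, 1, 0, 0; 0, 0, 0, 1, 0]
/-- exponents of the step unit `1 + X^ρ` on the new coordinates. -/
def b4 : Fin 5 → ℤ := ![0, -1, 0, 0, 1]
/-- the pivot. -/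
def rho4 : Fin 5 → ℤ := ![0, 0, 0, 0, 1]
/-- `r`-exponent of the pivot. -/
def alpha4 : Fin 5 →₀ ℕ := Finsupp.equivFunOnFinite.symm ![1, 1, 1, 1, 0]
/-- span-unit exponents of the step unit `1 + X^ρ`. -/
def m4 : Fin 10 → ℤ := ![0, 0, -1, 0, 0, 0, 0, 0, 0, 1]

/-- The step unit identity `E(m) = 1 + r^α·E(N ρ)` (a Plücker relation among span units). -/
theorem hU4 : ((E m4 : S5ˣ) : S5) = 1 + monomial alpha4 (1 : ℤ) * ((E (nMat4 *ᵥ rho4) : S5ˣ) : S5) := by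
  have hm : m4 = (delta 9) - (delta 2) := by funext i; fin_cases i <;> simp [m4, delta]
  have hn : nMat4 *ᵥ rho4 = (delta 8) - (delta 2) := by
    funext i; fin_cases i <;> simp [nMat4, rho4, delta, Matrix.mulVec, dotProduct, Fin.sum_univ_five]
  rw [hm, hn, monomial_eq_prod]
  refine E_sub_eq_one_add _ _ _ _ _ ?_
  simp [E_delta, alpha4, r]
  ring

/-- Chart 5 is CT-trivial. -/
theorem chart5_holds : CTTrivial (gam gMat5) (unitsOf nMat5) := by
  refine ctTrivial_next gMat4 nMat4 chart4_holds mu4 muInv4 ?_ b4 rho4 alpha4 ?_ ?_ m4 ?_ hU4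
    gMat5 nMat5 ?_ ?_
  · ext i j; fin_cases i <;> fin_cases j <;> simp [Matrix.mul_apply, Fin.sum_univ_five, mu4, muInv4]
  · intro h; have := congrArg (fun f => f 0) h; simp [alpha4] at this
  · funext j; fin_cases j <;> simp [gMat4, rho4, alpha4, zOf, Matrix.mulVec, dotProduct, Fin.sum_univ_five]
  · intro s i hi h
    have h0 := congrFun h 0; have h1 := congrFun h 1; have h2 := congrFun h 2; have h3 := congrFun h 3
    have h4 := congrFun h 4
    simp [mu4, rho4, dotProduct, Fin.sum_univ_five] at h0 h1 h2 h3 h4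
    simp [b4, dotProduct, Fin.sum_univ_five]
    omega
  · ext i j; fin_cases i <;> fin_cases j <;> simp [Matrix.mul_apply, Fin.sum_univ_five, gMat4, gMat5, mu4]
  · intro s; funext i
    fin_cases i <;> simp [nMat4, nMat5, mu4, b4, m4, Matrix.mulVec, dotProduct, Fin.sum_univ_five]
    ring

/-! ### Step 5: pivot coordinate 1 of chart 5 (flip `(0, 4)`) -/

/-- change-of-exponents matrix of step 5 (chart 6 basis → chart 5 basis). -/
def mu5 : Matrix (Fin 5) (Fin 5) ℤ := !![1, 0, 0, 0, 0; 0, 1, 0, 0, 0; 0, 0, 1, 0, 0; 0, 0, 0, 1, 0; 0, 0, 0, 0, 1]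
/-- its integer inverse. -/
def muInv5 : Matrix (Fin 5) (Fin 5) ℤ := !![1, 0, 0, 0, 0; 0, 1, 0, 0, 0; 0, 0, 1, 0, 0; 0, 0, 0, 1, 0; 0, 0, 0, 0, 1]
/-- exponents of the step unit `1 + X^ρ` on the new coordinates. -/
def b5 : Fin 5 → ℤ := ![1, 0, 0, 0, 1]
/-- the pivot. -/
def rho5 : Fin 5 → ℤ := ![0, 1, 0, 0, 0]
/-- `r`-exponent of the pivot. -/
def alpha5 : Fin 5 →₀ ℕ := Finsupp.equivFunOnFinite.symm ![0, 0, 1, 1, 0]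
/-- span-unit exponents of the step unit `1 + X^ρ`. -/
def m5 : Fin 10 → ℤ := ![0, 0, 1, 0, 0, -1, 0, 1, 0, -1]

/-- The step unit identity `E(m) = 1 + r^α·E(N ρ)` (a Plücker relation among span units). -/
theorem hU5 : ((E m5 : S5ˣ) : S5) = 1 + monomial alpha5 (1 : ℤ) * ((E (nMat5 *ᵥ rho5) : S5ˣ) : S5) := by
  have hm : m5 = (delta 2 + delta 7) - (delta 5 + delta 9) := by funext i; fin_cases i <;> simp [m5, delta]
  have hn : nMat5 *ᵥ rho5 = (delta 0 + delta 8) - (delta 5 + delta 9) := by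
    funext i; fin_cases i <;> simp [nMat5, rho5, delta, Matrix.mulVec, dotProduct, Fin.sum_univ_five]
  rw [hm, hn, monomial_eq_prod]
  refine E_sub_eq_one_add _ _ _ _ _ ?_
  simp [E_add, E_delta, alpha5, r]
  ring

/-- Chart 6 is CT-trivial. -/
theorem chart6_holds : CTTrivial (gam gMat6) (unitsOf nMat6) := by
  refine ctTrivial_next gMat5 nMat5 chart5_holds mu5 muInv5 ?_ b5 rho5 alpha5 ?_ ?_ m5 ?_ hU5
    gMat6 nMat6 ?_ ?_
  · ext i j; fin_cases i <;> fin_cases j <;> simp [Matrix.mul_apply, Fin.sum_univ_five, mu5, muInv5]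
  · intro h; have := congrArg (fun f => f 2) h; simp [alpha5] at this
  · funext j; fin_cases j <;> simp [gMat5, rho5, alpha5, zOf, Matrix.mulVec, dotProduct, Fin.sum_univ_five]
  · intro s i hi h
    have h0 := congrFun h 0; have h1 := congrFun h 1; have h2 := congrFun h 2; have h3 := congrFun h 3
    have h4 := congrFun h 4
    simp [mu5, rho5, dotProduct, Fin.sum_univ_five] at h0 h1 h2 h3 h4
    simp [b5, dotProduct, Fin.sum_univ_five]
    omega
  · ext i j; fin_cases i <;> fin_cases j <;> simp [Matrix.mul_apply, Fin.sum_univ_five, gMat5, gMat6, mu5]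
  · intro s; funext i
    fin_cases i <;> simp [nMat5, nMat6, mu5, b5, m5, Matrix.mulVec, dotProduct, Fin.sum_univ_five] <;> ring

/-! ## The base identity -/

/-- **`DualBaseIdentity` holds**: `Φ(0,t) = [t = 0]` for every `t ∈ ℤ⁵`. -/
theorem dualBaseIdentity_holds : DualBaseIdentity := by
  intro t
  by_cases ht : t = 0
  · subst ht
    have hc : cExp 0 0 = 0 := by funext j; fin_cases j <;> simp [cExp]
    have hn : nExp 0 0 = 0 := by funext j; fin_cases j <;> simp [nExp]
    rw [if_pos rfl, Phi, hc, hn, E_one_of 0 rfl, Units.val_one, coeffZ_one, if_pos rfl]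
  · rw [if_neg ht]
    set s : Fin 5 → ℤ := ![t 4, -t 2, t 0, t 1, t 3] with hs_def
    have hs : s ≠ 0 := by
      intro h; apply ht; funext j
      have h0 := congrFun h 0; have h1 := congrFun h 1; have h2 := congrFun h 2; have h3 := congrFun h 3
      have h4 := congrFun h 4
      simp [hs_def] at h0 h1 h2 h3 h4
      fin_cases j <;> simp <;> omega
    have hc : cExp 0 t = -(gMat6 *ᵥ s) := by
      funext j; fin_cases j <;> simp [cExp, gMat6, hs_def] <;> ring
    have hn : nExp 0 t = nMat6 *ᵥ s := by
      funext j; fin_cases j <;> simp [nExp, nMat6, hs_def, Matrix.mulVec, dotProduct, Fin.sum_univ_five] <;> ring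
    have := chart6_holds s hs
    rw [gam_apply, unitsOf_apply] at this
    rw [Phi, hc, hn]
    exact this

end DualR

end Summit.KontsevichZagierPeriods.Zeta5Search.Families.Cellular
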